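import Literature.AnabelianGeometry.EtaleTheta.ClassicalThetaProduct
import HarnessLib

/-!
# [EtTh] Proposition 1.4 (i) "each zero has multiplicity 1": `Θ̈′` at the cusps in closed form, and characteristic 2

Mochizuki, *The étale theta function and its Frobenioid-theoretic manifestations*, Publ. RIMS **45**
(2009) 227–349, Prop. 1.4 (i) [cite: MochizukiEtTh2009, Prop 1.4 (i) p.21] (PRIMS PDF p. 21 =
printed p. 247). Layer L2 of the abc-iut cell, wave-2 unit W2-L2-02 (seat abc-iut-L2-t6); proof-only
sequel to `ClassicalThetaProduct.lean` (`H(1) = ∏ (1 − q̈^{2n})³` from Jacobi's identity) and to this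
seat's `ClassicalThetaSimpleZeros.lean` (`Θ̈′(1) = 2 H(1)` over complete ultrametric fields, every
characteristic). No definitions, no named facts.

* `hasDerivAt_thetaDdot_one_tprod`, `deriv_thetaDdot_one_eq_tprod`, `deriv_thetaDdot_neg_one_eq_tprod` —
  over a complete ultrametric field, `‖q̈‖ < 1`: **`Θ̈′(±1) = 2 ∏_{n ≥ 1} (1 − q̈^{2n})³`**, the
  Tate-curve form of Jacobi's `ϑ₁′ = 2 q^{1/4} G³` (Whittaker–Watson Example 21.4.1; the tree's complex
  `theta1'_eq_two_mul_eta_pow_three`). Hence `Θ̈′(1) ≠ 0 ↔ 2 ≠ 0` (`deriv_thetaDdot_one_ne_zero_iff`):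
  the closed form of the dichotomy recorded by this seat's `ThetaDdotSimpleZeros'_holds` (simple zeros
  when `2 ≠ 0`, the paper's `K̈ ⊇ ℚ_p`) and `not_thetaDdotSimpleZeros` (the unrestricted fact, struck as
  FACT-LIST F-0496). At every cusp, with the constant explicit
  (`hasDerivAt_thetaDdot_zpow_mul_of_sq_eq_one`): **`Θ̈′(±q̈^a) = (−1)^a q̈^{−a(a+1)} · 2 ∏ (1 − q̈^{2n})³`**
  (`deriv_thetaDdot_zpow_eq`, `deriv_thetaDdot_neg_zpow_eq`, `deriv_thetaDdot_zpow_ne_zero_iff`).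
* `thetaDdot_eq_sub_one_sq_mul_of_two_eq_zero`, `tendsto_thetaDdot_div_sub_one_sq_of_two_eq_zero` —
  **characteristic 2: the zero of `Θ̈` at a cusp has order EXACTLY 2**: `Θ̈(Ü) = (Ü − 1)² · Ü H(Ü)` and
  `Θ̈(Ü)/(Ü − 1)² → ∏_{n ≥ 1} (1 − q̈^{2n})³ ≠ 0` as `Ü → 1` (`tprod_one_sub_qpow_succ_pow_three_ne_zero`).
  (The other cusps `±q̈^a` are carried to `±1` by the functional equations of Prop. 1.4 (ii).)

Prop. 1.4 is classical and undisputed. HONEST FRAMING: this file takes no side on any disputed claim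
of the IUT corpus; typed ≠ endorsed.
-/

noncomputable section

namespace Literature.AnabelianGeometry.EtaleTheta

open Filter
open scoped Topology

/-! ### Prop. 1.4 (i) "each zero has multiplicity 1": the derivative at the cusps in closed form -/

section Derivative

variable {L : Type*} [NontriviallyNormedField L] [CompleteSpace L] [IsUltrametricDist L] {q2 : L}

/-- **`Θ̈′(1) = 2 ∏_{n ≥ 1} (1 − q̈^{2n})³`** over a complete ultrametric field (`‖q̈‖ < 1`): the
Tate-curve form of Jacobi's `ϑ₁′ = 2 q^{1/4} G³`. Combines this seat's `hasDerivAt_thetaDdot_one`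
(`Θ̈′(1) = 2 H(1)`) with `H(1) = ∏ (1 − q̈^{2n})³`. [cite: MochizukiEtTh2009, Prop 1.4 (i) p.21] -/
theorem hasDerivAt_thetaDdot_one_tprod (hq : ‖q2‖ < 1) :
    HasDerivAt (thetaDdot q2) (2 * (∏' n : ℕ, (1 - q2 ^ (2 * (n + 1)))) ^ 3) 1 := by
  rw [← thetaDdotAux_one_eq_tprod_pow_three hq]
  exact hasDerivAt_thetaDdot_one hq

/-- `Θ̈′(1) = 2 ∏_{n ≥ 1} (1 − q̈^{2n})³`. [cite: MochizukiEtTh2009, Prop 1.4 (i) p.21] -/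
theorem deriv_thetaDdot_one_eq_tprod (hq : ‖q2‖ < 1) :
    deriv (thetaDdot q2) 1 = 2 * (∏' n : ℕ, (1 - q2 ^ (2 * (n + 1)))) ^ 3 :=
  (hasDerivAt_thetaDdot_one_tprod hq).deriv

/-- `Θ̈′(−1) = 2 ∏_{n ≥ 1} (1 − q̈^{2n})³` as well (`Θ̈` is odd). [cite: MochizukiEtTh2009, Prop 1.4 (i) p.21] -/
theorem deriv_thetaDdot_neg_one_eq_tprod (hq : ‖q2‖ < 1) :
    deriv (thetaDdot q2) (-1) = 2 * (∏' n : ℕ, (1 - q2 ^ (2 * (n + 1)))) ^ 3 := by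
  rw [← thetaDdotAux_one_eq_tprod_pow_three hq]
  exact (hasDerivAt_thetaDdot_neg_one hq).deriv

/-- **Simplicity of the zero at a cusp ⇔ `2 ≠ 0`** (closed form of the dichotomy behind
`ThetaDdotSimpleZeros'` / `not_thetaDdotSimpleZeros`): `Θ̈′(1) ≠ 0 ↔ (2 : L) ≠ 0`.
[cite: MochizukiEtTh2009, Prop 1.4 (i) p.21] -/
theorem deriv_thetaDdot_one_ne_zero_iff (hq : ‖q2‖ < 1) :
    deriv (thetaDdot q2) 1 ≠ 0 ↔ (2 : L) ≠ 0 := by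
  rw [deriv_thetaDdot_one_eq_tprod hq, mul_ne_zero_iff]
  exact ⟨fun h => h.1, fun h => ⟨h, pow_ne_zero 3 (tprod_one_sub_qpow_succ_ne_zero hq)⟩⟩

omit [CompleteSpace L] [IsUltrametricDist L] in
/-- **Transport to every cusp with the constant made explicit.** If `Ü₀² = 1`, `Θ̈(Ü₀) = 0` and
`Θ̈` has derivative `d` at `Ü₀`, then `Θ̈` has derivative `(−1)^a q̈^{−a(a+1)} d` at `q̈^a Ü₀`
(differentiate `Θ̈(q̈^a Ü) = (−1)^a q̈^{−a²} Ü^{−2a} Θ̈(Ü)`, Prop. 1.4 (ii), at `Ü = Ü₀`; this seat's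
`exists_hasDerivAt_thetaDdot_zpow_mul` gave the constant only up to a unit).
[cite: MochizukiEtTh2009, Prop 1.4 (ii) p.22] -/
theorem hasDerivAt_thetaDdot_zpow_mul_of_sq_eq_one (hq0 : q2 ≠ 0) {U₀ d : L} (hU₀ : U₀ ^ 2 = 1)
    (h0 : thetaDdot q2 U₀ = 0) (hd : HasDerivAt (thetaDdot q2) d U₀) (a : ℤ) :
    HasDerivAt (thetaDdot q2) (((a.negOnePow : ℤ) : L) * q2 ^ (-(a * (a + 1))) * d) (q2 ^ a * U₀) := by
  have hU₀0 : U₀ ≠ 0 := by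
    rintro rfl
    simp at hU₀
  have hqa : q2 ^ a ≠ 0 := zpow_ne_zero a hq0
  -- `Θ̈` is differentiable at `q̈^a Ü₀` (transport lemma), with some derivative `D`
  obtain ⟨c, -, hc⟩ := exists_hasDerivAt_thetaDdot_zpow_mul hq0 hU₀0 h0 hd a
  set D : L := c * d with hD
  -- chain rule for `g(Ü) := Θ̈(q̈^a Ü)` at `Ü₀`
  have hg1 : HasDerivAt (fun U : L => thetaDdot q2 (q2 ^ a * U)) (D * (q2 ^ a * 1)) U₀ :=
    hc.comp U₀ ((hasDerivAt_id U₀).const_mul (q2 ^ a))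
  -- the functional equation: `g(Ü) = (−1)^a q̈^{−a²} · Ü^{−2a} Θ̈(Ü)` near `Ü₀`
  set κ : L := ((a.negOnePow : ℤ) : L) * q2 ^ (-(a * a)) with hκ
  have hpow : U₀ ^ (-(2 * a)) = 1 := by
    rw [show -(2 * a) = 2 * (-a) by ring, zpow_mul, zpow_ofNat, hU₀, one_zpow]
  have hF : HasDerivAt (fun U : L => κ * (U ^ (-(2 * a)) * thetaDdot q2 U)) (κ * d) U₀ := by
    have h1 := ((hasDerivAt_zpow (-(2 * a)) U₀ (Or.inl hU₀0)).mul hd).const_mul κ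
    rw [h0, mul_zero, zero_add, hpow, one_mul] at h1
    exact h1
  have hg2 : HasDerivAt (fun U : L => thetaDdot q2 (q2 ^ a * U)) (κ * d) U₀ := by
    refine hF.congr_of_eventuallyEq ?_
    filter_upwards [eventually_ne_nhds hU₀0] with U hU
    rw [thetaDdot_zpow_mul hq0 hU a, hκ]
    ring
  -- compare the two derivatives of `g` at `Ü₀`
  have huniq : D * (q2 ^ a * 1) = κ * d := hg1.unique hg2
  have hDval : D = ((a.negOnePow : ℤ) : L) * q2 ^ (-(a * (a + 1))) * d := by
    have : D = κ * d * (q2 ^ a)⁻¹ := by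
      rw [← huniq, mul_one, mul_inv_cancel_right₀ hqa]
    rw [this, hκ, show -(a * (a + 1)) = -(a * a) + -a by ring, zpow_add₀ hq0, zpow_neg q2 a]
    ring
  rw [← hDval]
  exact hc

/-- **`Θ̈′(q̈^a) = (−1)^a q̈^{−a(a+1)} · 2 ∏_{n ≥ 1} (1 − q̈^{2n})³`** at every cusp `q̈^a`
(`0 < ‖q̈‖ < 1`, complete ultrametric field). [cite: MochizukiEtTh2009, Prop 1.4 (i) p.21] -/
theorem deriv_thetaDdot_zpow_eq (hq0 : q2 ≠ 0) (hq : ‖q2‖ < 1) (a : ℤ) :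
    deriv (thetaDdot q2) (q2 ^ a) =
      (-1) ^ a * q2 ^ (-(a * (a + 1))) * (2 * (∏' n : ℕ, (1 - q2 ^ (2 * (n + 1)))) ^ 3) := by
  have h := hasDerivAt_thetaDdot_zpow_mul_of_sq_eq_one hq0 (one_pow 2)
    (thetaDdot_one_of_norm_lt_one hq) (hasDerivAt_thetaDdot_one_tprod hq) a
  rw [mul_one] at h
  rw [h.deriv, Int.cast_negOnePow]

/-- **`Θ̈′(−q̈^a) = (−1)^a q̈^{−a(a+1)} · 2 ∏_{n ≥ 1} (1 − q̈^{2n})³`** at every cusp `−q̈^a` (`Θ̈′` is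
even). [cite: MochizukiEtTh2009, Prop 1.4 (i) p.21] -/
theorem deriv_thetaDdot_neg_zpow_eq (hq0 : q2 ≠ 0) (hq : ‖q2‖ < 1) (a : ℤ) :
    deriv (thetaDdot q2) (-(q2 ^ a)) =
      (-1) ^ a * q2 ^ (-(a * (a + 1))) * (2 * (∏' n : ℕ, (1 - q2 ^ (2 * (n + 1)))) ^ 3) := by
  have hd : HasDerivAt (thetaDdot q2) (2 * (∏' n : ℕ, (1 - q2 ^ (2 * (n + 1)))) ^ 3) (-1) := by
    rw [← thetaDdotAux_one_eq_tprod_pow_three hq]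
    exact hasDerivAt_thetaDdot_neg_one hq
  have h := hasDerivAt_thetaDdot_zpow_mul_of_sq_eq_one hq0 (by norm_num : (-1 : L) ^ 2 = 1)
    (by rw [thetaDdot_neg, thetaDdot_one_of_norm_lt_one hq, neg_zero]) hd a
  rw [mul_neg_one] at h
  rw [h.deriv, Int.cast_negOnePow]

/-- Hence, for `2 ≠ 0` (the paper's `K̈ ⊇ ℚ_p`), the CLOSED FORM of "each zero has multiplicity 1":
`Θ̈′(±q̈^a) ≠ 0` with the explicit value above; for `2 = 0` every `Θ̈′(±q̈^a)` vanishes.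
[cite: MochizukiEtTh2009, Prop 1.4 (i) p.21] -/
theorem deriv_thetaDdot_zpow_ne_zero_iff (hq0 : q2 ≠ 0) (hq : ‖q2‖ < 1) (a : ℤ) :
    deriv (thetaDdot q2) (q2 ^ a) ≠ 0 ↔ (2 : L) ≠ 0 := by
  rw [deriv_thetaDdot_zpow_eq hq0 hq, mul_ne_zero_iff, mul_ne_zero_iff, mul_ne_zero_iff]
  refine ⟨fun h => h.2.1, fun h => ⟨⟨?_, zpow_ne_zero _ hq0⟩, h, ?_⟩⟩
  · exact zpow_ne_zero _ (neg_ne_zero.mpr one_ne_zero)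
  · exact pow_ne_zero 3 (tprod_one_sub_qpow_succ_ne_zero hq)

end Derivative

/-! ### Characteristic 2: the zero at a cusp has order exactly 2 -/

section CharTwo

variable {L : Type*} [NontriviallyNormedField L] [CompleteSpace L] [IsUltrametricDist L] {q2 : L}

/-- In characteristic `2`, `Θ̈(Ü) = (Ü − 1)² · Ü H(Ü)` (`Ü ≠ 0`): the factor `Ü² − 1` of
`Θ̈(Ü) = Ü (Ü² − 1) H(Ü)` is the square `(Ü − 1)²`. [cite: MochizukiEtTh2009, Prop 1.4 (i) p.21] -/
theorem thetaDdot_eq_sub_one_sq_mul_of_two_eq_zero (hq : ‖q2‖ < 1) (h2 : (2 : L) = 0) {U : L}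
    (hU : U ≠ 0) : thetaDdot q2 U = (U - 1) ^ 2 * (U * thetaDdotAux q2 U) := by
  have hsq : U ^ 2 - 1 = (U - 1) ^ 2 := by
    have : (U - 1) ^ 2 = U ^ 2 - 1 - 2 * (U - 1) := by ring
    rw [this, h2, zero_mul, sub_zero]
  rw [thetaDdot_eq_mul_thetaDdotAux hq hU, hsq]
  ring

/-- **Characteristic 2: the zero of `Θ̈` at the cusp `Ü = 1` has order EXACTLY 2**:
`Θ̈(Ü)/(Ü − 1)² → ∏_{n ≥ 1} (1 − q̈^{2n})³` as `Ü → 1`, `Ü ≠ 1`, and this limit is non-zero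
(`tprod_one_sub_qpow_succ_ne_zero`). (So the struck fact `ThetaDdotSimpleZeros` fails in
characteristic `2` by exactly one order.) [cite: MochizukiEtTh2009, Prop 1.4 (i) p.21] -/
theorem tendsto_thetaDdot_div_sub_one_sq_of_two_eq_zero (hq : ‖q2‖ < 1) (h2 : (2 : L) = 0) :
    Tendsto (fun U : L => thetaDdot q2 U / (U - 1) ^ 2) (𝓝[≠] 1)
      (𝓝 ((∏' n : ℕ, (1 - q2 ^ (2 * (n + 1)))) ^ 3)) := by
  have hcont : ContinuousAt (thetaDdotAux q2) 1 :=
    (continuousOn_thetaDdotAux hq).continuousAt (Metric.ball_mem_nhds 1 one_pos)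
  have hg : Tendsto (fun U : L => U * thetaDdotAux q2 U) (𝓝 1) (𝓝 (1 * thetaDdotAux q2 1)) :=
    (continuous_id.continuousAt.mul hcont).tendsto
  rw [one_mul, thetaDdotAux_one_eq_tprod_pow_three hq] at hg
  refine (hg.mono_left nhdsWithin_le_nhds).congr' ?_
  have hball : Metric.ball (1 : L) 1 ∈ 𝓝[≠] (1 : L) :=
    mem_nhdsWithin_of_mem_nhds (Metric.ball_mem_nhds 1 one_pos)
  filter_upwards [self_mem_nhdsWithin, hball] with U hU1 hUb
  have hU : U ≠ 0 := by
    rintro rfl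
    simp at hUb
  have hne : (U - 1) ^ 2 ≠ 0 := pow_ne_zero 2 (sub_ne_zero.mpr hU1)
  rw [thetaDdot_eq_sub_one_sq_mul_of_two_eq_zero hq h2 hU, mul_div_cancel_left₀ _ hne]

end CharTwo

end Literature.AnabelianGeometry.EtaleTheta
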